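import Summits.BirchSwinnertonDyer.BirchSwinnertonDyer.Theorems.ManinLocalTwoThreeGenerationTwoParabolicGuarded
import HarnessLib

/-!
# E-es-22 through PARABOLIC relative Ihara with EXACT odd levels `t ∥ L'` (consumer clone for es's E-es-36x, MEMO-es §25.11)

Summit `BirchSwinnertonDyer`, route `ManinLocalTwoThree` (cell bsd-f2-manin), crux C2 `ManinOddAtFour` (stmt-BirchSwinnertonDyer-22967),
registered stub `stub_cThreeImageResidual` (the 3 950 `C₃`-image classes; also bears on crux C3 stmt-BirchSwinnertonDyer-22968 through
the shared leaf family).  Sequel to `Theorems/ManinLocalTwoThreeGenerationTwoParabolic{,Guarded}.lean` (p3): the parabolic telescope now also pins the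
LEVELS at which the odd-prime instances fire (`v_t(L') = 1`), matching es's E-es-36x `RelativeIharaShiftVanishingParOddExact`
(binders `t ∣ L → ¬ t ^ 2 ∣ L →`), so that the `k ≥ 2` odd-index descent of §25.11(b) is never needed (MEMO-es §25.1, §25.4, §25.11).

* `eq_zero_of_altSum_conjAt_eq_zero_parabolic_exact` — the parabolic telescope with the total level fixed, so that each
  single-shift instance fires at a level `L'` with `L' d ∣ M` (es 04:36Z (2): «thread ¬ t² ∣ L′ into hvanq»);
* `functional_eq_zero_of_parabolicShiftVanishing_two_exact` — per-curve core; the odd instances fire only at `t ∣ L'`, `t² ∤ L'`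
  (`v_t(M) = 2` for `M = N·8·∏_{q∥N} q`);
* **`multiShiftClassGenerationTwo_of_parabolicVanishing_exact`** — E-es-22 for all `W[2]`-irreducible classes (including `C₃`)
  from E-es-36o(2,2,3)-shaped and E-es-36x(2,t,1)-shaped parabolic vanishing — so the odd-`t` leaf prover needs ONLY the vertex
  step `k = 1`.

Nothing about BSD or Manin's conjecture is proved here.  References: HOME/MEMO-es.md §25 (cell bsd-f2-manin).
-/

set_option autoImplicit false
set_option linter.dupNamespace false

noncomputable section

open scoped Classical MatrixGroups ModularForm BigOperators

open CongruenceSubgroup Matrix.SpecialLinearGroup ModularGroup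
  Literature.NumberTheory.EllipticCurves Literature.NumberTheory.EllipticCurves.ModularForms
  Literature.NumberTheory.EllipticCurves.ModularForms.HidaCohomology
  Summit.BirchSwinnertonDyer.Rank1Residual.ManinAdditive

namespace Summit.BirchSwinnertonDyer.BirchSwinnertonDyer.Theorems.ManinLocalTwoThree

/-- **Telescope, parabolic form with exact levels**: as `eq_zero_of_altSum_conjAt_eq_zero_parabolic`, with the total level `M`
fixed and the single-step vanishing at modulus `d` required only at levels `L'` with `L' d ∣ M` (so the consumer can read off
`v_d(L')` from `v_d(M)`). [folklore] -/
theorem eq_zero_of_altSum_conjAt_eq_zero_parabolic_exact {K : Type*} [Field K] (S : Finset ℕ) (lam : ℕ → K) (B M : ℕ)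
    [NeZero M] :
    ∀ (ds : List ℕ), ds.Nodup → (∀ d ∈ ds, 0 < d) →
      (∀ d ∈ ds, ∀ (L' : ℕ) [NeZero L'] [NeZero d] (v : cocycles 0 L' K), B ∣ L' → L' * d ∣ M →
        (∀ q : ℕ, q.Prime → q ∣ L' * d → q ∈ S) → IsHeckeGenEigenvector S lam v →
        (∀ γ : Gamma0 L', ∀ c : OnePoint ℚ, mapGL ℚ (γ : SL(2, ℤ)) • c = c → (v : Gamma0 L' → Fin 1 → K) γ 0 = 0) →
        degeneracyPullback 0 L' (L' * d) d K dvd_rfl (v : Gamma0 L' → Fin 1 → K) =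
          degeneracyPullback 0 L' (L' * d) 1 K (by simp) (v : Gamma0 L' → Fin 1 → K) →
        v = 0) →
      ∀ (L : ℕ) [NeZero L], B ∣ L → M = L * ds.prod → (∀ q : ℕ, q.Prime → q ∣ M → q ∈ S) →
        ∀ u : cocycles 0 L K, IsHeckeGenEigenvector S lam u →
          (∀ γ : Gamma0 L, ∀ c : OnePoint ℚ, mapGL ℚ (γ : SL(2, ℤ)) • c = c → (u : Gamma0 L → Fin 1 → K) γ 0 = 0) →
          (∀ (γ : Gamma0 M) (i : Fin 1),
            ∑ T ∈ ds.toFinset.powerset,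
              (-1 : ℤ) ^ T.card • (u : Gamma0 L → Fin 1 → K) (conjAt L M (∏ t ∈ T, t) γ) i = 0) →
          u = 0 := by
  intro ds
  induction ds with
  | nil =>
    intro _ _ _ L _ _ hM _ u _ _ hsum
    have hML : M = L := by simpa using hM
    subst hML
    apply Subtype.ext
    funext γ i
    have h := hsum γ i
    simp only [List.toFinset_nil, Finset.powerset_empty, Finset.sum_singleton, Finset.card_empty, pow_zero,
      Finset.prod_empty, one_smul, conjAt_self_one] at h
    exact h
  | cons d ds ih =>
    intro hnd hpos hRI L _ hB hM hS u hu hupar hsum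
    obtain ⟨hdds, hnd'⟩ := List.nodup_cons.mp hnd
    have hd0 : 0 < d := hpos d List.mem_cons_self
    haveI : NeZero d := NeZero.of_pos hd0
    haveI : NeZero (L * d) := ⟨Nat.mul_ne_zero (NeZero.ne L) hd0.ne'⟩
    have hLdM : L * d ∣ M := ⟨ds.prod, by rw [hM, List.prod_cons, mul_assoc]⟩
    have hS₁ : ∀ q : ℕ, q.Prime → q ∣ L * d → q ∈ S := fun q hq hqd => hS q hq (hqd.trans hLdM)
    set v : cocycles 0 (L * d) K :=
      degeneracyPullbackZ 0 L (L * d) d K dvd_rfl u - degeneracyPullbackZ 0 L (L * d) 1 K (by simp) u with hv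
    have hvgen : IsHeckeGenEigenvector S lam v := by
      intro ℓ _ hℓ hℓS
      exact Submodule.sub_mem _ (isHeckeGenEigenvector_degeneracyPullbackZ dvd_rfl hS₁ hu ℓ hℓ hℓS)
        (isHeckeGenEigenvector_degeneracyPullbackZ (by simp) hS₁ hu ℓ hℓ hℓS)
    have hcoe : (v : Gamma0 (L * d) → Fin 1 → K) =
        degeneracyPullback 0 L (L * d) d K dvd_rfl (u : Gamma0 L → Fin 1 → K) -
          degeneracyPullback 0 L (L * d) 1 K (by simp) (u : Gamma0 L → Fin 1 → K) := by
      rw [hv, Submodule.coe_sub, coe_degeneracyPullbackZ, coe_degeneracyPullbackZ]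
    -- NEW: `v` is parabolic
    have hvpar : ∀ γ : Gamma0 (L * d), ∀ c : OnePoint ℚ, mapGL ℚ (γ : SL(2, ℤ)) • c = c →
        (v : Gamma0 (L * d) → Fin 1 → K) γ 0 = 0 := by
      intro γ c hc
      rw [hcoe]
      exact parabolic_degeneracyPullback_sub dvd_rfl (by simp) _ hupar γ c hc
    have hdnot : d ∉ ds.toFinset := fun h => hdds (List.mem_toFinset.mp h)
    have hsum' : ∀ (γ : Gamma0 M) (i : Fin 1),
        ∑ T ∈ ds.toFinset.powerset,
          (-1 : ℤ) ^ T.card • (v : Gamma0 (L * d) → Fin 1 → K) (conjAt (L * d) M (∏ t ∈ T, t) γ) i = 0 := by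
      intro γ i
      have h := hsum γ i
      rw [List.toFinset_cons,
        sum_powerset_insert_alternating hdnot (fun D => (u : Gamma0 L → Fin 1 → K) (conjAt L M D γ) i),
        sub_eq_zero] at h
      have hterm : ∀ T ∈ ds.toFinset.powerset,
          (-1 : ℤ) ^ T.card • (v : Gamma0 (L * d) → Fin 1 → K) (conjAt (L * d) M (∏ t ∈ T, t) γ) i =
            (-1 : ℤ) ^ T.card • (u : Gamma0 L → Fin 1 → K) (conjAt L M (d * ∏ t ∈ T, t) γ) i -
              (-1 : ℤ) ^ T.card • (u : Gamma0 L → Fin 1 → K) (conjAt L M (∏ t ∈ T, t) γ) i := by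
        intro T hT
        have hTpos : (∏ t ∈ T, t) ≠ 0 := Finset.prod_ne_zero_iff.mpr fun t ht =>
          (hpos t (List.mem_cons_of_mem d (List.mem_toFinset.mp (Finset.mem_powerset.mp hT ht)))).ne'
        have hTdvd : L * d * ∏ t ∈ T, t ∣ M := by
          rw [hM, List.prod_cons, ← mul_assoc]
          refine mul_dvd_mul_left (L * d) ?_
          have hprod : ds.prod = ∏ t ∈ ds.toFinset, t := by
            rw [List.prod_toFinset (fun t : ℕ => t) hnd', List.map_id']
          rw [hprod]
          exact Finset.prod_dvd_prod_of_subset _ _ _ (Finset.mem_powerset.mp hT)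
        rw [← smul_sub, hcoe, Pi.sub_apply, Pi.sub_apply, degeneracyPullback_zero_eq_conjAt,
          degeneracyPullback_zero_eq_conjAt, conjAt_conjAt hTpos hd0.ne' hTdvd dvd_rfl,
          conjAt_conjAt hTpos one_ne_zero hTdvd (by simp), one_mul]
      rw [Finset.sum_congr rfl hterm, Finset.sum_sub_distrib, sub_eq_zero]
      exact h.symm
    have hv0 : v = 0 :=
      ih hnd' (fun e he => hpos e (List.mem_cons_of_mem d he)) (fun e he => hRI e (List.mem_cons_of_mem d he))
        (L * d) (hB.mul_right d) (by rw [hM, List.prod_cons, mul_assoc]) hS v hvgen hvpar hsum'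
    have heq : degeneracyPullback 0 L (L * d) d K dvd_rfl (u : Gamma0 L → Fin 1 → K) =
        degeneracyPullback 0 L (L * d) 1 K (by simp) (u : Gamma0 L → Fin 1 → K) := by
      rw [← sub_eq_zero, ← hcoe, hv0, Submodule.coe_zero]
    exact hRI d List.mem_cons_self L u hB hLdM hS₁ hu hupar heq

/-- **Per-curve core at `p = 2`, parabolic form, EXACT odd levels**: the odd-prime vanishing hypothesis is required only for primes
`t ∥ N` and only at levels `L'` with `t ∣ L'`, `t² ∤ L'` (`v_t(L') = 1` at every firing level `L' = N·8·q₁⋯q_{j−1}` of the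
telescope) — the binders of es's E-es-36x `RelativeIharaShiftVanishingParOddExact` (MEMO-es §25.11). [folklore] -/
theorem functional_eq_zero_of_parabolicShiftVanishing_two_exact {W : WeierstrassCurve ℚ} [W.IsElliptic] {N : ℕ} [NeZero N]
    {f : CuspForm (Gamma0 N) 2} (hf : IsNewformOf W f) (h4 : 2 ^ 2 ∣ N) (φ : ↥(periodLattice f) →+ ZMod 2)
    (hφ : ∀ x : ↥(periodLattice f), (x : ℂ) ∈
      periodLattice (∑ T ∈ (insert 8 (N.primeFactors.filter fun q => ¬ q ^ 2 ∣ N)).powerset,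
        (-1 : ℂ) ^ T.card • degeneracyMap0 N (8 * N ^ 2) (∏ t ∈ T, t - 1 + 1) 2 f) → φ x = 0)
    (hvan8 : ∀ (L' : ℕ) [NeZero L'] (S : Finset ℕ) (v : cocycles 0 L' (ZMod 2)), N ∣ L' →
      (∀ q : ℕ, q.Prime → q ∣ 2 * 2 * L' → q ∈ S) →
      IsHeckeGenEigenvector S (fun ℓ : ℕ => ((W.LFunction ℓ : ℤ) : ZMod 2)) v →
      (∀ γ : Gamma0 L', ∀ c : OnePoint ℚ, mapGL ℚ (γ : SL(2, ℤ)) • c = c → (v : Gamma0 L' → Fin 1 → ZMod 2) γ 0 = 0) →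
      degeneracyPullback 0 L' (L' * 2 ^ 3) (2 ^ 3) (ZMod 2) dvd_rfl (v : Gamma0 L' → Fin 1 → ZMod 2) =
        degeneracyPullback 0 L' (L' * 2 ^ 3) 1 (ZMod 2) (by simp) (v : Gamma0 L' → Fin 1 → ZMod 2) →
      v = 0)
    (hvanq : ∀ t : ℕ, t.Prime → t ≠ 2 → t ∣ N → ¬ t ^ 2 ∣ N →
      ∀ (L' : ℕ) [NeZero L'] [NeZero t] (S : Finset ℕ) (v : cocycles 0 L' (ZMod 2)), N ∣ L' → t ∣ L' → ¬ t ^ 2 ∣ L' →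
      (∀ q : ℕ, q.Prime → q ∣ 2 * t * L' → q ∈ S) →
      IsHeckeGenEigenvector S (fun ℓ : ℕ => ((W.LFunction ℓ : ℤ) : ZMod 2)) v →
      (∀ γ : Gamma0 L', ∀ c : OnePoint ℚ, mapGL ℚ (γ : SL(2, ℤ)) • c = c → (v : Gamma0 L' → Fin 1 → ZMod 2) γ 0 = 0) →
      degeneracyPullback 0 L' (L' * t ^ 1) (t ^ 1) (ZMod 2) dvd_rfl (v : Gamma0 L' → Fin 1 → ZMod 2) =
        degeneracyPullback 0 L' (L' * t ^ 1) 1 (ZMod 2) (by simp) (v : Gamma0 L' → Fin 1 → ZMod 2) →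
      v = 0) :
    φ = 0 := by
  haveI : Fact (Nat.Prime 2) := ⟨Nat.prime_two⟩
  have hN0 : 0 < N := Nat.pos_of_ne_zero (NeZero.ne N)
  have h4' : 4 ∣ N := by norm_num at h4; exact h4
  have h2N : 2 ∣ N := dvd_trans (by norm_num) h4'
  set G : Finset ℕ := N.primeFactors.filter fun q => ¬ q ^ 2 ∣ N with hG
  have hGprime : ∀ q ∈ G, q.Prime ∧ ¬ q ^ 2 ∣ N := fun q hq => by
    rw [hG, Finset.mem_filter] at hq
    exact ⟨(Nat.mem_primeFactors.mp hq.1).1, hq.2⟩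
  have hGne2 : ∀ q ∈ G, q ≠ 2 := by
    rintro q hq rfl
    exact (hGprime 2 hq).2 h4
  set ds : List ℕ := (2 ^ 3) :: (G.toList.map fun t => t ^ 1) with hds
  have hmap : (G.toList.map fun t => t ^ 1) = G.toList := by simp
  have h8G : (2 ^ 3 : ℕ) ∉ G.toList := fun h => by
    have h8 := (hGprime _ (Finset.mem_toList.mp h)).1
    norm_num at h8
  have hnd : ds.Nodup := by
    rw [hds, hmap]
    exact List.nodup_cons.mpr ⟨h8G, Finset.nodup_toList G⟩
  have hpos : ∀ d ∈ ds, 0 < d := by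
    intro d hd
    rw [hds, hmap] at hd
    rcases List.mem_cons.mp hd with rfl | hd
    · norm_num
    · exact (hGprime d (Finset.mem_toList.mp hd)).1.pos
  have hdsF : ds.toFinset = insert 8 G := by
    rw [hds, hmap, List.toFinset_cons, Finset.toList_toFinset]
    norm_num
  have hprod0 : ds.prod ≠ 0 := fun h0 => lt_irrefl 0 (hpos 0 (List.prod_eq_zero_iff.mp h0))
  set M : ℕ := N * ds.prod with hM
  have hM0 : M ≠ 0 := Nat.mul_ne_zero (NeZero.ne N) hprod0
  haveI : NeZero M := ⟨hM0⟩
  have hNM : N ∣ M := dvd_mul_right N _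
  have hL : 1 < M := lt_of_lt_of_le (by omega : 1 < N) (Nat.le_of_dvd (Nat.pos_of_ne_zero hM0) hNM)
  set S : Finset ℕ := M.primeFactors with hS
  have hSM : ∀ q : ℕ, q.Prime → q ∣ M → q ∈ S := fun q hq hqd =>
    (Nat.mem_primeFactors_of_ne_zero hM0).mpr ⟨hq, hqd⟩
  set u : cocycles 0 N (ZMod 2) :=
    ⟨fun (γ : Gamma0 N) (_ : Fin 1) => φ ⟨cuspSymbol f γ, cuspSymbol_mem_periodLattice f γ⟩,
      functionalCocycle_mem_cocycles f φ⟩ with hu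
  have hgen : IsHeckeGenEigenvector S (fun ℓ : ℕ => ((W.LFunction ℓ : ℤ) : ZMod 2)) u :=
    isHeckeGenEigenvector_functionalCocycle hf φ S
  have hupar : ∀ γ : Gamma0 N, ∀ c : OnePoint ℚ, mapGL ℚ (γ : SL(2, ℤ)) • c = c →
      (u : Gamma0 N → Fin 1 → ZMod 2) γ 0 = 0 := fun γ c hc => periodFunctional_parabolic f φ γ hc
  have hRI : ∀ d ∈ ds, ∀ (L' : ℕ) [NeZero L'] [NeZero d] (v : cocycles 0 L' (ZMod 2)), N ∣ L' → L' * d ∣ M →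
      (∀ q : ℕ, q.Prime → q ∣ L' * d → q ∈ S) →
      IsHeckeGenEigenvector S (fun ℓ : ℕ => ((W.LFunction ℓ : ℤ) : ZMod 2)) v →
      (∀ γ : Gamma0 L', ∀ c : OnePoint ℚ, mapGL ℚ (γ : SL(2, ℤ)) • c = c → (v : Gamma0 L' → Fin 1 → ZMod 2) γ 0 = 0) →
      degeneracyPullback 0 L' (L' * d) d (ZMod 2) dvd_rfl (v : Gamma0 L' → Fin 1 → ZMod 2) =
        degeneracyPullback 0 L' (L' * d) 1 (ZMod 2) (by simp) (v : Gamma0 L' → Fin 1 → ZMod 2) →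
      v = 0 := by
    intro d hd
    rw [hds] at hd
    rcases List.mem_cons.mp hd with rfl | hd
    · intro L' _ _ v hNL _ hS' hv hvp heq
      refine hvan8 L' S v hNL (fun q hq hqd => ?_) hv hvp heq
      rcases (Nat.Prime.dvd_mul hq).mp hqd with h | h
      · have h2 : q ∣ 2 := by rcases (Nat.Prime.dvd_mul hq).mp h with h | h <;> exact h
        have hq2 : q = 2 := (Nat.prime_dvd_prime_iff_eq hq Nat.prime_two).mp h2
        subst hq2
        exact hS' 2 hq (dvd_mul_of_dvd_right (by norm_num) _)
      · exact hS' q hq (h.mul_right _)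
    · obtain ⟨t, ht, rfl⟩ := List.mem_map.mp hd
      have htp := (hGprime t (Finset.mem_toList.mp ht)).1
      have ht2 := hGne2 t (Finset.mem_toList.mp ht)
      have htsq := (hGprime t (Finset.mem_toList.mp ht)).2
      have htN : t ∣ N := by
        have hmem := Finset.mem_toList.mp ht
        rw [hG, Finset.mem_filter] at hmem
        exact Nat.dvd_of_mem_primeFactors hmem.1
      intro L' _ _ v hNL hLdM hS' hv hvp heq
      haveI : NeZero t := ⟨htp.ne_zero⟩
      have htL' : t ∣ L' := htN.trans hNL
      -- `v_t(M) = 2`: `M = N · 8 · ∏_{q ∈ G} q`, `t ∥ N`, `t ∈ G`, `t ∤ 8`; so `t² ∣ L'` would give `t³ ∣ L' t ∣ M`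
      have htsqL' : ¬ t ^ (1 + 1) ∣ L' := by
        intro h2
        have h3 : t ^ 3 ∣ M := by
          have : t ^ 3 ∣ L' * t ^ 1 := by
            rw [show t ^ 3 = t ^ (1 + 1) * t ^ 1 by ring]; exact mul_dvd_mul h2 dvd_rfl
          exact this.trans hLdM
        -- `M = N * (8 * ∏ G)`, and `t² ∤ N`, `t ∥ ∏ G`, `t ∤ 8`
        have hprodG : (G.toList.map fun t => t ^ 1).prod = ∏ q ∈ G, q := by
          rw [hmap]
          have h0 := List.prod_toFinset (fun q : ℕ => q) (Finset.nodup_toList G)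
          rw [List.map_id', Finset.toList_toFinset] at h0
          exact h0.symm
        have hM' : M = N * (2 ^ 3 * ((∏ q ∈ G.erase t, q) * t)) := by
          rw [hM, hds, List.prod_cons, hprodG, ← Finset.prod_erase_mul G (fun q => q) (Finset.mem_toList.mp ht)]
        have hcop8 : Nat.Coprime t (2 ^ 3) :=
          (Nat.Coprime.pow_right 3 ((Nat.coprime_primes htp Nat.prime_two).2 ht2))
        have hcopR : Nat.Coprime t (∏ q ∈ G.erase t, q) := by
          refine Nat.Coprime.prod_right fun q hq => ?_
          have hq' := Finset.mem_erase.mp hq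
          exact (Nat.coprime_primes htp (hGprime q hq'.2).1).2 (Ne.symm hq'.1)
        -- strip one `t` and the coprime part
        have h2N : t ^ 2 ∣ N * (2 ^ 3 * ∏ q ∈ G.erase t, q) := by
          have e : M = N * (2 ^ 3 * ∏ q ∈ G.erase t, q) * t := by rw [hM']; ring
          rw [e, show t ^ 3 = t ^ 2 * t by ring] at h3
          exact (Nat.mul_dvd_mul_iff_right htp.pos).mp h3
        have hcop : Nat.Coprime (t ^ 2) (2 ^ 3 * ∏ q ∈ G.erase t, q) :=
          Nat.Coprime.pow_left 2 (Nat.Coprime.mul_right hcop8 hcopR)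
        exact htsq ((hcop.dvd_of_dvd_mul_right h2N))
      refine hvanq t htp ht2 htN htsq L' S v hNL htL' htsqL' (fun q hq hqd => ?_) hv hvp heq
      rcases (Nat.Prime.dvd_mul hq).mp hqd with h | h
      · rcases (Nat.Prime.dvd_mul hq).mp h with h | h
        · have hq2 : q = 2 := (Nat.prime_dvd_prime_iff_eq hq Nat.prime_two).mp h
          subst hq2
          exact hS' 2 hq ((h2N.trans hNL).mul_right _)
        · exact hS' q hq (dvd_mul_of_dvd_right (by rw [pow_one]; exact h) _)
      · exact hS' q hq (h.mul_right _)
  have hsum : ∀ (γ : Gamma0 M) (i : Fin 1),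
      ∑ T ∈ ds.toFinset.powerset,
        (-1 : ℤ) ^ T.card • (u : Gamma0 N → Fin 1 → ZMod 2) (conjAt N M (∏ t ∈ T, t) γ) i = 0 := by
    intro γ i
    have he : ((γ : SL(2, ℤ)) 1 1 : ℤ) ≠ 0 := apply_one_one_ne_zero_of_one_lt hL γ
    have hterm : ∀ T ∈ ds.toFinset.powerset,
        (-1 : ℤ) ^ T.card • (u : Gamma0 N → Fin 1 → ZMod 2) (conjAt N M (∏ t ∈ T, t) γ) i =
          φ ((-1 : ℤ) ^ T.card •
            ⟨cuspSymbol f (conjAt N M (∏ t ∈ T, t) γ), cuspSymbol_mem_periodLattice f _⟩) := by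
      intro T _
      rw [map_zsmul]
    rw [Finset.sum_congr rfl hterm, ← map_sum]
    apply hφ
    rw [AddSubmonoidClass.coe_finsetSum, periodLattice_multiShiftOldform_eq_closure_columns f h4', ← hdsF]
    apply AddSubgroup.subset_closure
    refine ⟨((γ : SL(2, ℤ)) 0 1 : ℤ), ((γ : SL(2, ℤ)) 1 1 : ℤ), he, ?_, ?_⟩
    · have hN' : IsCoprime ((γ : SL(2, ℤ)) 1 1 : ℤ) (M : ℤ) := isCoprime_apply_one_one_level γ
      exact (hN'.of_isCoprime_of_dvd_right (Int.natCast_dvd_natCast.mpr hNM)).mul_right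
        (isCoprime_apply_zero_one_apply_one_one γ).symm
    · refine Finset.sum_congr rfl fun T hT => ?_
      have hTpos : (∏ t ∈ T, t) ≠ 0 := Finset.prod_ne_zero_iff.mpr fun t ht =>
        (hpos t (List.mem_toFinset.mp (Finset.mem_powerset.mp hT ht))).ne'
      haveI : NeZero (∏ t ∈ T, t) := ⟨hTpos⟩
      have hTdvd : N * ∏ t ∈ T, t ∣ M := by
        refine mul_dvd_mul_left N ?_
        have hprod : ds.prod = ∏ t ∈ ds.toFinset, t := by
          rw [List.prod_toFinset (fun t : ℕ => t) hnd, List.map_id']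
        rw [hprod]
        exact Finset.prod_dvd_prod_of_subset _ _ _ (Finset.mem_powerset.mp hT)
      have h01 : ((Gamma0.degeneracyConj N M (∏ t ∈ T, t) hTdvd γ : SL(2, ℤ)) 0 1 : ℤ) =
          ((∏ t ∈ T, t : ℕ) : ℤ) * (γ : SL(2, ℤ)) 0 1 := rfl
      have h11 : ((Gamma0.degeneracyConj N M (∏ t ∈ T, t) hTdvd γ : SL(2, ℤ)) 1 1 : ℤ) =
          (γ : SL(2, ℤ)) 1 1 := rfl
      rw [AddSubgroupClass.coe_zsmul]
      show (-1 : ℤ) ^ T.card • cuspSymbol f (conjAt N M (∏ t ∈ T, t) γ) = _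
      rw [conjAt_eq hTdvd γ, cuspSymbol_eq_modularSymbol_div_sub f _ (by rw [h11]; exact he), h01, h11,
        zsmul_eq_mul]
      have harg : ((((∏ t ∈ T, t : ℕ) : ℤ) * (γ : SL(2, ℤ)) 0 1 : ℤ) : ℚ) / (((γ : SL(2, ℤ)) 1 1 : ℤ) : ℚ) =
          ((((γ : SL(2, ℤ)) 0 1 * ∏ t ∈ T, (t : ℤ) : ℤ)) : ℚ) / (((γ : SL(2, ℤ)) 1 1 : ℤ) : ℚ) := by
        push_cast
        ring
      rw [harg]
      push_cast
      ring
  have hu0 : u = 0 :=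
    eq_zero_of_altSum_conjAt_eq_zero_parabolic_exact S _ N M ds hnd hpos hRI N (dvd_refl N) hM hSM u hgen hupar hsum
  ext x
  have hx : (x : ℂ) ∈ (periodLattice f : Set ℂ) := x.2
  rw [coe_periodLattice_eq_range] at hx
  obtain ⟨γ, hγ⟩ := hx
  have hxγ : x = ⟨cuspSymbol f γ, cuspSymbol_mem_periodLattice f γ⟩ := Subtype.ext hγ.symm
  have h0 : (u : Gamma0 N → Fin 1 → ZMod 2) γ 0 = 0 := by rw [hu0]; rfl
  rw [hxγ, AddMonoidHom.zero_apply]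
  exact h0


/-- **E-es-22 for ALL `W[2]`-irreducible classes — the consumer clone of MEMO-es §25 with EXACT odd levels**: the odd-prime
parabolic vanishing is needed only for `t ∥ N`, at levels `L'` with `t ∣ L'`, `t² ∤ L'` — the binders of es's E-es-36x
`RelativeIharaShiftVanishingParOddExact 2 t 1` — and the `2³`-instance unguarded (E-es-36o(2,2,3)); the hNT hypotheses of those
leaves come from E-es-40₂ / E-es-40 (`W[2]` irreducible). [folklore] -/
theorem multiShiftClassGenerationTwo_of_parabolicVanishing_exact
    (hvan8 : ∀ (W : WeierstrassCurve ℚ) [W.IsElliptic], W.HasIrreducibleModPGaloisRep 2 →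
      ∀ (L' : ℕ) [NeZero L'] (S : Finset ℕ) (v : cocycles 0 L' (ZMod 2)),
      (∀ q : ℕ, q.Prime → q ∣ 2 * 2 * L' → q ∈ S) →
      IsHeckeGenEigenvector S (fun ℓ : ℕ => ((W.LFunction ℓ : ℤ) : ZMod 2)) v →
      (∀ γ : Gamma0 L', ∀ c : OnePoint ℚ, mapGL ℚ (γ : SL(2, ℤ)) • c = c → (v : Gamma0 L' → Fin 1 → ZMod 2) γ 0 = 0) →
      degeneracyPullback 0 L' (L' * 2 ^ 3) (2 ^ 3) (ZMod 2) dvd_rfl (v : Gamma0 L' → Fin 1 → ZMod 2) =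
        degeneracyPullback 0 L' (L' * 2 ^ 3) 1 (ZMod 2) (by simp) (v : Gamma0 L' → Fin 1 → ZMod 2) →
      v = 0)
    (hvanq : ∀ (W : WeierstrassCurve ℚ) [W.IsElliptic] {N : ℕ} [NeZero N] (f : CuspForm (Gamma0 N) 2), IsNewformOf W f →
      W.HasIrreducibleModPGaloisRep 2 → ∀ t : ℕ, t.Prime → t ≠ 2 → t ∣ N → ¬ t ^ 2 ∣ N →
      ∀ (L' : ℕ) [NeZero L'] [NeZero t] (S : Finset ℕ) (v : cocycles 0 L' (ZMod 2)), N ∣ L' → t ∣ L' → ¬ t ^ 2 ∣ L' →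
      (∀ q : ℕ, q.Prime → q ∣ 2 * t * L' → q ∈ S) →
      IsHeckeGenEigenvector S (fun ℓ : ℕ => ((W.LFunction ℓ : ℤ) : ZMod 2)) v →
      (∀ γ : Gamma0 L', ∀ c : OnePoint ℚ, mapGL ℚ (γ : SL(2, ℤ)) • c = c → (v : Gamma0 L' → Fin 1 → ZMod 2) γ 0 = 0) →
      degeneracyPullback 0 L' (L' * t ^ 1) (t ^ 1) (ZMod 2) dvd_rfl (v : Gamma0 L' → Fin 1 → ZMod 2) =
        degeneracyPullback 0 L' (L' * t ^ 1) 1 (ZMod 2) (by simp) (v : Gamma0 L' → Fin 1 → ZMod 2) →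
      v = 0) :
    MultiShiftClassGenerationTwo := by
  haveI : Fact (Nat.Prime 2) := ⟨Nat.prime_two⟩
  rw [multiShiftClassGenerationTwo_iff_functionals]
  intro W _ N _ f hf h4 hirr φ hφ
  refine functional_eq_zero_of_parabolicShiftVanishing_two_exact hf h4 φ hφ ?_ ?_
  · intro L' _ S v _ hS hv hvp heq
    exact hvan8 W hirr L' S v hS hv hvp heq
  · intro t ht ht2 htN htsq L' _ _ S v hNL htL' htsqL' hS hv hvp heq
    exact hvanq W f hf hirr t ht ht2 htN htsq L' S v hNL htL' htsqL' hS hv hvp heq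

end Summit.BirchSwinnertonDyer.BirchSwinnertonDyer.Theorems.ManinLocalTwoThree

end
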